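import Summits.QuantumFields.YangMills.Theorems.SwapVirialDeficitBlowUpGnomonicBFibreRescaledSockets
import Summits.QuantumFields.YangMills.Theorems.SwapVirialDeficitGnomonicTaylorHubLineB
import HarnessLib

/-!
# STUB (S-B) OF SKELETON ➎, SOCKETS part 2c: THE `|u|`-UNIFORM CUBIC DATUM OF THE RESCALED B-FIBRE (K7e read on rescaled B-rays)
# (free-hands support of ⟨stmt-QuantumFields-24197⟩ `SwapVirialDeficit.SwapGluedStiffness` ∕ ⟨24194⟩; cell ym-idea-1, LEAD memo7 §E(3))

✓`bFibre_rescaled_sockets` bounds the cubic datum of `G_u(y) = F_B(Ψ′_B(u,y))` only in PLAIN letters, `≤ 1136016L⁴‖D_u y‖³ ≤ 1136016L⁴(1+|u|²)^{3∕2}‖y‖³`.  With K7e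
(✓`taylor_four_gnoDeficit_hubLine_B`: the `x₀`-size normalised by the transverse base `√(1+|u|²)`) the SAME constant holds UNIFORMLY in `u`: along every rescaled B-ray
from any fibre point over `u` the `x`-letter is `(√(1+|u|²)(z₀ + s w)_{x₀}, u₁, u₂)` — transverse part exactly `u` — so K7e's hypothesis `√Σ(ξ.1.1)² ≤ S·√(1+|u|²)` holds
with `S = ‖w‖`.
* §1 `contDiff_bFibre_rescaled`, `bFibre_rescaled_ray`, `transverse_base_add_emb_gnoScaleB`, `letterSizes_gnoScaleB_le` (K7e's five size hypotheses for `ξ = gnoFibreBEmb (D_u w)`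
  at any point with transverse base `u`, `S = ‖w‖`);
* §2 ★ `bFibre_rescaled_lineJets` (the four jets `1008∕39984∕6816096∕1464571584·L⁴‖w‖ᵏ` along `s ↦ F_B(p + s·gnoFibreBEmb (D_u w))` for EVERY `p` over `u`),
  ★ `bFibre_rescaled_third_bound` (`|D³_y F_B(gnoBaseB u + gnoFibreBEmb (D_u ·))(z₀)[w,w,w]| ≤ 6816096L⁴‖w‖³` at every `z₀`, uniformly in `u`);
* §3 ★★★ `bFibre_rescaled_cubic (ε) (hz) (hε) (u) (y)` : `|F_B(Ψ′_B(u,y)) − ½·(d²∕ds²)F_B(gnoBaseB u + s·gnoFibreBEmb(D_u y))|₀| ≤ 1136016L⁴‖y‖³` for EVERY `u ∈ ℝ²` and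
  `y ∈ V_B` (✓`cubicDatum_of_third`; flat ∕ critical base ✓`bDeficit_gnoBaseB_eq_zero` ∕ minimality) — the `hρ` socket of the B-law with `A₃ = 1136016L⁴`, NO cap on `|u|`.

HONEST LABEL: (S-B), (S-core), (S-001), ⟨24197⟩ ∕ ⟨24194⟩ OPEN; own crux ⟨22884⟩ OPEN (blocked-on ⟨19935⟩); the Yang–Mills mass gap is NOT proved; no summit is proved by a line.
THEOREMS ONLY (0 `def`, 0 `sorry`), standard axioms.  Width seat ym-line-sfw-p2-w2 g59 (cell ym-idea-1, free hands), `--supports stmt-QuantumFields-24197`.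
References: [cite: Luscher1983, §2]; [folklore].
-/

set_option autoImplicit false
set_option synthInstance.maxSize 1024

noncomputable section

open MeasureTheory Quaternion Set Metric
open scoped BigOperators Quaternion InnerProductSpace ENNReal
open Literature.MathematicalPhysics.QuantumFieldTheory hiding SU2
open Literature.MathematicalPhysics.QuantumLattice

namespace Summit.QuantumFields.YangMills.Theorems.SwapVirialDeficit.BlowUpRing

open Summit.QuantumFields.YangMills.Theorems.FemtoTransferGap
open Summit.QuantumFields.YangMills.Theorems.FemtoTransferGap.TT
open Summit.QuantumFields.YangMills.Theorems.VirialFluxGap.RingDeficit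
open Summit.QuantumFields.YangMills.Theorems.SwapVirialDeficit.SwapRing
open Summit.QuantumFields.YangMills.Theorems.SwapVirialDeficit.Gnomonic (normSq3 normSq3_nonneg taylor_four_gnoDeficit_hubLine_B)
open Summit.QuantumFields.YangMills.Theorems.QuantitativeLaplace (iteratedFDeriv_two_eq_lineJet third_bound_of_lineJet cubicDatum_of_third)

variable {L : ℕ} [NeZero L]

/-! ## §1 The rescaled fibre restriction, its rays and letter sizes -/

/-- The rescaling `D_u` is `C^∞` (a linear map of a finite-dimensional space). [folklore] -/
theorem contDiff_gnoScaleB (u : ℝ × ℝ) {n : ℕ∞} : ContDiff ℝ n (gnoScaleB (L := L) u) := by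
  have h := (LinearMap.toContinuousLinearMap (gnoScaleBLin (L := L) u)).contDiff (n := n)
  have e : ⇑(LinearMap.toContinuousLinearMap (gnoScaleBLin (L := L) u)) = gnoScaleB u := by
    rw [LinearMap.coe_toContinuousLinearMap']; rfl
  rw [e] at h
  exact h

/-- `y ↦ F_B(p + gnoFibreBEmb (D_u y))` is `C^n` for every expansion point `p` and base `u`. [cite: Luscher1983, §2] -/
theorem contDiff_bFibre_rescaled (z : Fin 3 → Bool) (χ : Site 3 L → SU2) (ε : GnoSign L) (p : ℝ × GnoCoord L) (u : ℝ × ℝ) {n : ℕ∞} :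
    ContDiff ℝ n fun y : GnoFibreB L => gnoDeficit z χ (hubAt (p + gnoFibreBEmb (gnoScaleB u y)).1 1) ε (p + gnoFibreBEmb (gnoScaleB u y)).2 :=
  (contDiff_bDeficit_fibre (n := n) z χ ε p).comp (contDiff_gnoScaleB u)

/-- Rays of the rescaled fibre restriction: `F_B(p + gnoFibreBEmb (D_u (z₀ + s·w))) = F_B((p + gnoFibreBEmb (D_u z₀)) + s·gnoFibreBEmb (D_u w))`. [folklore] -/
theorem bFibre_rescaled_ray (z : Fin 3 → Bool) (χ : Site 3 L → SU2) (ε : GnoSign L) (p : ℝ × GnoCoord L) (u : ℝ × ℝ) (z₀ w : GnoFibreB L) :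
    (fun s : ℝ => gnoDeficit z χ (hubAt (p + gnoFibreBEmb (gnoScaleB u (z₀ + s • w))).1 1) ε (p + gnoFibreBEmb (gnoScaleB u (z₀ + s • w))).2) =
      fun s : ℝ => gnoDeficit z χ (hubAt ((p + gnoFibreBEmb (gnoScaleB u z₀)) + s • gnoFibreBEmb (gnoScaleB u w)).1 1) ε
        ((p + gnoFibreBEmb (gnoScaleB u z₀)) + s • gnoFibreBEmb (gnoScaleB u w)).2 := by
  funext s
  have e : gnoScaleB u (z₀ + s • w) = gnoScaleB u z₀ + s • gnoScaleB u w := by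
    rw [← gnoScaleBLin_apply, map_add, map_smul]; rfl
  rw [e, map_add, map_smul, add_assoc]

/-- Over the base `u` the transverse `x`-letters of `p + gnoFibreBEmb (D_u z₀)` are those of `p` (the B-fibre does not move `x_⊥`). [folklore] -/
theorem transverse_add_emb_gnoScaleB (p : ℝ × GnoCoord L) (u : ℝ × ℝ) (z₀ : GnoFibreB L) :
    (p + gnoFibreBEmb (gnoScaleB u z₀)).2.1.1 1 = p.2.1.1 1 ∧ (p + gnoFibreBEmb (gnoScaleB u z₀)).2.1.1 2 = p.2.1.1 2 := by
  rw [Prod.snd_add, gnoFibreBEmb_gnoScaleB]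
  simp

omit [NeZero L] in
/-- The base point `gnoBaseB u` has transverse `x`-letters `u`. [folklore] -/
theorem transverse_gnoBaseB (u : ℝ × ℝ) : (gnoBaseB (L := L) u).2.1.1 1 = u.1 ∧ (gnoBaseB (L := L) u).2.1.1 2 = u.2 := by
  simp [gnoBaseB]

/-- ★ K7e's SIZE HYPOTHESES for the rescaled direction `ξ = gnoFibreBEmb (D_u w)`, `S = ‖w‖`: `|ξ_δ| ≤ ‖w‖`, `ξ.1.1 1 = ξ.1.1 2 = 0`,
`√Σ(ξ.1.1)² ≤ ‖w‖·√(1+|u|²)`, `√Σ(ξ.1.2)² ≤ ‖w‖`, `√Σ(ξ.2.1)² ≤ ‖w‖`, `√Σ(ξ.2.2 i)² ≤ ‖w‖`. [folklore] -/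
theorem letterSizes_gnoScaleB_le (u : ℝ × ℝ) (w : GnoFibreB L) :
    |(gnoFibreBEmb (gnoScaleB u w)).1| ≤ ‖w‖ ∧ (gnoFibreBEmb (gnoScaleB u w)).2.1.1 1 = 0 ∧ (gnoFibreBEmb (gnoScaleB u w)).2.1.1 2 = 0 ∧
      Real.sqrt (∑ k, (gnoFibreBEmb (gnoScaleB u w)).2.1.1 k ^ 2) ≤ ‖w‖ * Real.sqrt (1 + (u.1 ^ 2 + u.2 ^ 2)) ∧
      Real.sqrt (∑ k, (gnoFibreBEmb (gnoScaleB u w)).2.1.2 k ^ 2) ≤ ‖w‖ ∧ Real.sqrt (∑ k, (gnoFibreBEmb (gnoScaleB u w)).2.2.1 k ^ 2) ≤ ‖w‖ ∧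
      ∀ i, Real.sqrt (∑ k, (gnoFibreBEmb (gnoScaleB u w)).2.2.2 i k ^ 2) ≤ ‖w‖ := by
  obtain ⟨hδ, -, hy, hz, hf⟩ := letterSizes_gnoFibreBEmb_le (L := L) w
  have hn : 0 ≤ ‖w‖ := norm_nonneg _
  have hc0 : 0 ≤ Real.sqrt (1 + (u.1 ^ 2 + u.2 ^ 2)) := Real.sqrt_nonneg _
  -- letters of the plain and of the rescaled direction
  have eδ : (gnoFibreBEmb (gnoScaleB u w)).1 = (gnoFibreBEmb w).1 := by rw [gnoFibreBEmb_gnoScaleB, gnoFibreBEmb_apply]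
  have ey : (gnoFibreBEmb (gnoScaleB u w)).2.1.2 = (gnoFibreBEmb w).2.1.2 := by rw [gnoFibreBEmb_gnoScaleB, gnoFibreBEmb_apply]
  have ez : (gnoFibreBEmb (gnoScaleB u w)).2.2.1 = (gnoFibreBEmb w).2.2.1 := by rw [gnoFibreBEmb_gnoScaleB, gnoFibreBEmb_apply]
  have ef : (gnoFibreBEmb (gnoScaleB u w)).2.2.2 = (gnoFibreBEmb w).2.2.2 := by rw [gnoFibreBEmb_gnoScaleB, gnoFibreBEmb_apply]
  have ex1 : (gnoFibreBEmb (gnoScaleB u w)).2.1.1 1 = 0 := by rw [gnoFibreBEmb_gnoScaleB]; simp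
  have ex2 : (gnoFibreBEmb (gnoScaleB u w)).2.1.1 2 = 0 := by rw [gnoFibreBEmb_gnoScaleB]; simp
  have ex : ∑ k, (gnoFibreBEmb (gnoScaleB u w)).2.1.1 k ^ 2 = (Real.sqrt (1 + (u.1 ^ 2 + u.2 ^ 2)) * w (Sum.inl (Sum.inl 1))) ^ 2 := by
    rw [Fin.sum_univ_three, ex1, ex2, gnoFibreBEmb_gnoScaleB]
    simp
  refine ⟨by rw [eδ]; exact hδ, ex1, ex2, ?_, by rw [ey]; exact hy, by rw [ez]; exact hz, fun i => by rw [ef]; exact hf i⟩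
  rw [ex, Real.sqrt_sq_eq_abs, abs_mul, abs_of_nonneg hc0, mul_comm]
  refine mul_le_mul_of_nonneg_right ?_ hc0
  -- `|w_{x₀}| ≤ ‖w‖`
  have h1 : w (Sum.inl (Sum.inl 1)) ^ 2 ≤ ‖w‖ ^ 2 := by
    rw [norm_sq_gnoFibreB_letters]
    nlinarith [sq_nonneg (w (Sum.inl (Sum.inl 0))), sq_nonneg (w (Sum.inl (Sum.inl 2))), sq_nonneg (w (Sum.inl (Sum.inr 0))), sq_nonneg (w (Sum.inl (Sum.inr 1))),
      normSq3_nonneg (fun k => w (Sum.inr (Sum.inl k))), Finset.sum_nonneg fun f (_ : f ∈ Finset.univ) => normSq3_nonneg (fun k => w (Sum.inr (Sum.inr (f, k))))]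
  exact abs_le_of_sq_le_sq' h1 hn |> fun h => abs_le.2 h

/-! ## §2 Jets along rescaled B-rays, uniformly in the base -/

/-- ★ **K7e's LINE JETS along a rescaled B-ray over `u`, letter size `S = ‖w‖`, UNIFORM in `u`**: for every expansion point `p` whose transverse `x`-letters are `u`,
with `ψ s = F_B(p + s·gnoFibreBEmb (D_u w))`: `|ψ′| ≤ 1008L⁴‖w‖`, `|ψ″| ≤ 39984L⁴‖w‖²`, `|ψ‴| ≤ 6816096L⁴‖w‖³`, `|ψ⁗| ≤ 1464571584L⁴‖w‖⁴` everywhere. [cite: Luscher1983, §2] -/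
theorem bFibre_rescaled_lineJets (z : Fin 3 → Bool) (χ : Site 3 L → SU2) (ε : GnoSign L) (u : ℝ × ℝ) (p : ℝ × GnoCoord L)
    (hp1 : p.2.1.1 1 = u.1) (hp2 : p.2.1.1 2 = u.2) (w : GnoFibreB L) (s : ℝ) :
    |deriv (fun s : ℝ => gnoDeficit z χ (hubAt (p + s • gnoFibreBEmb (gnoScaleB u w)).1 1) ε (p + s • gnoFibreBEmb (gnoScaleB u w)).2) s| ≤ 1008 * (L : ℝ) ^ 4 * ‖w‖ ∧
      |iteratedDeriv 2 (fun s : ℝ => gnoDeficit z χ (hubAt (p + s • gnoFibreBEmb (gnoScaleB u w)).1 1) ε (p + s • gnoFibreBEmb (gnoScaleB u w)).2) s| ≤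
        39984 * (L : ℝ) ^ 4 * ‖w‖ ^ 2 ∧
      |iteratedDeriv 3 (fun s : ℝ => gnoDeficit z χ (hubAt (p + s • gnoFibreBEmb (gnoScaleB u w)).1 1) ε (p + s • gnoFibreBEmb (gnoScaleB u w)).2) s| ≤
        6816096 * (L : ℝ) ^ 4 * ‖w‖ ^ 3 ∧
      |iteratedDeriv 4 (fun s : ℝ => gnoDeficit z χ (hubAt (p + s • gnoFibreBEmb (gnoScaleB u w)).1 1) ε (p + s • gnoFibreBEmb (gnoScaleB u w)).2) s| ≤
        1464571584 * (L : ℝ) ^ 4 * ‖w‖ ^ 4 := by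
  obtain ⟨hδ, h1, h2, hx, hy, hz, hf⟩ := letterSizes_gnoScaleB_le (L := L) u w
  have hδ' : |(-(gnoFibreBEmb (gnoScaleB u w)).1)| ≤ ‖w‖ * ‖(hubAt p.1 1).im‖ := by
    rw [abs_neg, norm_im_hubAt_one, mul_one]; exact hδ
  have hx' : Real.sqrt (∑ k, (gnoFibreBEmb (gnoScaleB u w)).2.1.1 k ^ 2) ≤ ‖w‖ * Real.sqrt (1 + (p.2.1.1 1 ^ 2 + p.2.1.1 2 ^ 2)) := by
    rw [hp1, hp2]; exact hx
  have h := (taylor_four_gnoDeficit_hubLine_B z χ (hubAt_one_im_ne_zero p.1) (-(gnoFibreBEmb (gnoScaleB u w)).1) ε p.2 (gnoFibreBEmb (gnoScaleB u w)).2 h1 h2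
    (norm_nonneg w) hδ' hx' hy hz hf).1 s
  rw [bDeficit_ray_eq_hubLine]
  exact h

/-- ★ **THE DIRECTIONAL THIRD DERIVATIVE OF THE RESCALED B-FIBRE, UNIFORM IN `u`**: `|D³_y F_B(gnoBaseB u + gnoFibreBEmb (D_u ·))(z₀)[w,w,w]| ≤ 6816096L⁴‖w‖³` at EVERY
fibre point `z₀` and every base `u` (✓`third_bound_of_lineJet`; the ray from `z₀` sits over the transverse base `u`, `transverse_add_emb_gnoScaleB`). [cite: Luscher1983, §2] -/
theorem bFibre_rescaled_third_bound (z : Fin 3 → Bool) (χ : Site 3 L → SU2) (ε : GnoSign L) (u : ℝ × ℝ) (z₀ w : GnoFibreB L) :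
    |iteratedFDeriv ℝ 3 (fun y : GnoFibreB L => gnoDeficit z χ (hubAt (gnoBaseB u + gnoFibreBEmb (gnoScaleB u y)).1 1) ε
        (gnoBaseB u + gnoFibreBEmb (gnoScaleB u y)).2) z₀ (fun _ => w)| ≤ 6816096 * (L : ℝ) ^ 4 * ‖w‖ ^ 3 := by
  refine third_bound_of_lineJet (S := univ) (contDiff_bFibre_rescaled (n := 3) z χ ε (gnoBaseB u) u) (fun z₁ _ ξ => ?_) z₀ (mem_univ _) w
  rw [bFibre_rescaled_ray]
  obtain ⟨e1, e2⟩ := transverse_add_emb_gnoScaleB (L := L) (gnoBaseB u) u z₁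
  obtain ⟨b1, b2⟩ := transverse_gnoBaseB (L := L) u
  exact (bFibre_rescaled_lineJets z χ ε u (gnoBaseB u + gnoFibreBEmb (gnoScaleB u z₁)) (by rw [e1, b1]) (by rw [e2, b2]) ξ 0).2.2.1

/-! ## §3 The uniform cubic datum -/

/-- The rescaled fibre restriction vanishes at the origin of the fibre over a B-base point (principal signs). [folklore] -/
theorem bFibre_rescaled_base_apply_zero (ε : GnoSign L) (hz : ε.2.1 = true) (hF : ε.2.2 = fun _ => true) (u : ℝ × ℝ) :
    (fun y : GnoFibreB L => gnoDeficit (fun _ => false) (fun _ => 1) (hubAt (gnoBaseB u + gnoFibreBEmb (gnoScaleB u y)).1 1) ε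
      (gnoBaseB u + gnoFibreBEmb (gnoScaleB u y)).2) 0 = 0 := by
  have e : gnoScaleB (L := L) u 0 = 0 := by rw [← gnoScaleBLin_apply, map_zero]
  simp only [e, map_zero, add_zero]
  exact bDeficit_gnoBaseB_eq_zero ε hz hF u

/-- The rescaled fibre restriction is critical at the origin (minimality: `F_B ≥ 0 = F_B(base)`). [folklore] -/
theorem fderiv_bFibre_rescaled_base_eq_zero (ε : GnoSign L) (hz : ε.2.1 = true) (hF : ε.2.2 = fun _ => true) (u : ℝ × ℝ) :
    fderiv ℝ (fun y : GnoFibreB L => gnoDeficit (fun _ => false) (fun _ => 1) (hubAt (gnoBaseB u + gnoFibreBEmb (gnoScaleB u y)).1 1) ε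
      (gnoBaseB u + gnoFibreBEmb (gnoScaleB u y)).2) 0 = 0 := by
  refine IsLocalMin.fderiv_eq_zero (Filter.Eventually.of_forall fun y => ?_)
  rw [bFibre_rescaled_base_apply_zero ε hz hF u]
  exact gnoDeficit_nonneg _ _ _ _ _

/-- ★★★ **THE `|u|`-UNIFORM CUBIC DATUM OF THE RESCALED B-FIBRE** (principal signs): for EVERY base `u ∈ ℝ²` and `y ∈ V_B`,
`|F_B(Ψ′_B(u,y)) − ½·(d²∕ds²)F_B(gnoBaseB u + s·gnoFibreBEmb(D_u y))|₀| ≤ 1136016L⁴‖y‖³` (✓`cubicDatum_of_third` with `h3` = `bFibre_rescaled_third_bound`; the ray second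
derivative is `⟪A′_u y, y⟫` of ✓`bFibre_rescaled_sockets` ∕ ✓`bTube_fibred_scaled_cylinder`). [cite: Luscher1983, §2] -/
theorem bFibre_rescaled_cubic (ε : GnoSign L) (hz : ε.2.1 = true) (hF : ε.2.2 = fun _ => true) (u : ℝ × ℝ) (y : GnoFibreB L) :
    |gnoDeficit (fun _ => false) (fun _ => 1) (hubAt (gnoFibreBEquiv (u, gnoScaleB u y)).1 1) ε (gnoFibreBEquiv (u, gnoScaleB u y)).2 -
        (1 / 2) * iteratedDeriv 2 (fun s : ℝ => gnoDeficit (fun _ => false) (fun _ => 1) (hubAt (gnoBaseB u + s • gnoFibreBEmb (gnoScaleB u y)).1 1) ε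
          (gnoBaseB u + s • gnoFibreBEmb (gnoScaleB u y)).2) 0| ≤ 1136016 * (L : ℝ) ^ 4 * ‖y‖ ^ 3 := by
  have hg := contDiff_bFibre_rescaled (n := 3) (fun _ => false) (fun _ => 1) ε (gnoBaseB (L := L) u) u
  have hg2 := contDiff_bFibre_rescaled (n := 2) (fun _ => false) (fun _ => 1) ε (gnoBaseB (L := L) u) u
  have h := cubicDatum_of_third (R := ‖y‖) (A₃ := 6816096 * (L : ℝ) ^ 4) hg (bFibre_rescaled_base_apply_zero ε hz hF u) (fderiv_bFibre_rescaled_base_eq_zero ε hz hF u)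
    (fun z₀ _ w => bFibre_rescaled_third_bound _ _ ε u z₀ w) y le_rfl
  -- the Hessian form at `0` is the ray second derivative
  have eH : iteratedFDeriv ℝ 2 (fun y : GnoFibreB L => gnoDeficit (fun _ => false) (fun _ => 1) (hubAt (gnoBaseB u + gnoFibreBEmb (gnoScaleB u y)).1 1) ε
        (gnoBaseB u + gnoFibreBEmb (gnoScaleB u y)).2) 0 (fun _ => y) =
      iteratedDeriv 2 (fun s : ℝ => gnoDeficit (fun _ => false) (fun _ => 1) (hubAt (gnoBaseB u + s • gnoFibreBEmb (gnoScaleB u y)).1 1) ε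
        (gnoBaseB u + s • gnoFibreBEmb (gnoScaleB u y)).2) 0 := by
    rw [iteratedFDeriv_two_eq_lineJet hg2 0 y, bFibre_rescaled_ray]
    have e0 : gnoScaleB (L := L) u 0 = 0 := by rw [← gnoScaleBLin_apply, map_zero]
    simp only [e0, map_zero, add_zero]
  rw [eH] at h
  rw [gnoFibreBEquiv_apply]
  refine h.trans (le_of_eq ?_)
  ring

end Summit.QuantumFields.YangMills.Theorems.SwapVirialDeficit.BlowUpRing

end
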